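import Literature.MathematicalPhysics.QuantumFieldTheory.Balaban1983to89.B9Thm313WholeDvFromDds
import Literature.MathematicalPhysics.QuantumFieldTheory.Balaban1983to89.B9GradViaDivLettersAtPins
import Literature.MathematicalPhysics.QuantumFieldTheory.Balaban1983to89.B9DirSupHolderAtPins

/-!
# `Balaban1983to89.B9Thm313WholeDvProbeAtPins` — [B9] Theorems 3.12–3.13 (pp. 420–426): THE HÖLDER-PROBE LETTER Φ^X_β∘G₀∘D_U OF ROWS 20–21
# (`Letters313HZ.pXDv`) AT THE N06 CERTIFICATE'S PINS — `B9Thm313WholeDvFromDds.pXDv_of_h43Rd` ∘ (n06-w5's slice relabelling of the DERIVED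
# `Thm33G0Dir.h43R` to the direction letters) ∘ (`B9GradViaDivLettersAtPins`: `D_U = Σ_μ ∇*_{U,μ}∘J_μ`, the sup letter of `J_μ`)

T. Bałaban, *Propagators for lattice gauge theories in a background field*, Commun. Math. Phys. **99** (1985) 389–434
[`Balaban1985BackgroundPropagators`, "B9"]; [4] = T. Bałaban, *Propagators and renormalization transformations for lattice gauge
theories. II*, Commun. Math. Phys. **96** (1984) 223–250 [`Balaban1984PropagatorsII`].

statement-level skeleton of published theorems with citation tags; proofs where landed; nothing here is a claim about the Yang–Mills
mass gap

THE POINT.  `pXDv_of_h43Rd` needs the DIRECTIONAL right-probe member `Φ^X_β∘(G₀∇*_{U,μ})` for every μ; rows 19 derive the slice-diagonal one,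
`Thm33G0Dir.h43R : Φ^X_β∘(G₀∘∇*_U)` (`𝔬.Dstar` = n06-d's `DscoK`, slot ν ↦ ∇*_{U,ν}).  At the pins the probes `Φ^X = probeK …` READ ONE SLICE and their anchors
`blkPK` are slot-blind, so n06-w5's `B9DirSupHolderAtPins.hasMajorantHom_probe_constSlice_of_family` relabels: ★ `h43Rd_of_pins`.  Composing with
`B9GradViaDivLettersAtPins.DvcoKH_eq_sum ∕ hasMaj_JcoKH_pins`: ★★ `pXDv_pins` — the displayed field `Letters313HZ.pXDv` of `hLH3`, every member, every `Reg335`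
configuration, from the derived `h43R` alone (`Bx ≥ (d+1)·B_h·C_J·c`, `C_J = cR39·e^{δ_J·rJ}`, `0 ≤ δ₃ ≤ δ₀`, `δ₃ + σ ≤ δ_J`).

HONEST SCOPE.  Composition of landed modules; nothing of print's estimates asserted; COUNT-NEUTRAL; N06 NOT discharged; one finite lattice at a time; nothing
continuum, nothing about the mass gap.  Cell `pub-ymgap` (HUMAN RULING D-0062), Track A node N06 [B9], rows 20–21 (bundle F7), seat `pub-ymgap-dag-n06-l` (g17),
2026-08-28.
-/

noncomputable section

namespace Literature.MathematicalPhysics.QuantumFieldTheory.Balaban1983to89.B9Thm313WholeDvProbeAtPins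

open Node00 B6GlobalChartV1 B6KLevelCensusIndexV1 B9BackgroundsKLevelV1
open B6Geom246MultiLevelTorus (geomT)
open B6Ineq2142KLevelV1 (β)
open B6RandomWalkHom (HasMajorantHom)
open B9Eq39Adjoint (R)
open B11SectG (HasMaj RowSum)
open B9Thm34Ext (toB6)
open B9Thm312Whole (cNorm GeoOK Ops)
open B9Thm312WholeClasses (cNormR)
open B9RWSums343Holder (HolderProbes)
open B9Thm39ReadingCoords (cR39 cR39_nonneg)
open B9GeoNormsKLevelV1 (geo9K)
open B9CoReadingCoords (XBK coordOpK cdsBₗ blkBK GcoK DscoK)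
open B9CoReadingCoordsH (XHK)
open B9CoReadingCoordsS (XSK blkSK sIK)
open B9CoReadingCoordsHolder (PK blkPK probeK)
open B9CoReadingCoordsTranspose (TrIdx trBasis)
open B9PinMembersKLevelV1 (MemberY geo9Y bg9Y)
open B7Prop2SpecialUnitary (specialUnitaryUnits)
open Node00.OpsYSectDCoords (DvcoKH)
open B9DirSupAtPins (smul_coordOpK_comp_smul_coordOpK)
open B9DirSupHolderAtPins (hasMajorantHom_probe_constSlice_of_family)
open B9GradViaDivLettersAtPins (JcoKH rJ DvcoKH_eq_sum hasMaj_JcoKH_pins)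
open B9Thm313WholeDvFromDds (pXDv_of_h43Rd)
open scoped Matrix.Norms.L2Operator

variable {d ℓ : ℕ} {hd : 1 ≤ d + 1} {hL : Odd (ℓ + 1) ∧ 1 < ℓ + 1} {b₀ b₁ : ℝ}

/-! ## §1 The directional right-probe member from the slice-diagonal one, every configuration -/

section Pins

variable {𝔸 : Type} [NormedRing 𝔸] [NormedAlgebra ℂ 𝔸] [CompleteSpace 𝔸] [FiniteDimensional ℝ 𝔸]
variable {κ : Type} [Fintype κ]
variable (i : KIdx d ℓ hd hL b₀ b₁) (b : Module.Basis κ ℝ 𝔸) (B : B9.Backgrounds) (cfg : B.Cfg → CfgY 𝔸 i)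
variable [Fintype (geo9K i).Site]

/-- ★ **Φ∘(G₀∇*_{U,μ}) FROM Φ∘(G₀∇*_U) AT THE PINS** (the `h43Rd` input of `pXDv_of_h43Rd` from the shape of `Thm33G0Dir.h43R`): with `G₀ = GcoK` (slice-constant,
`cR39 •`), `∇*_U = DscoK` (slot ν ↦ ∇*_{U,ν}) and the direction letters `coordOpK b (fun _ => ∇*_{U,μ})`, `G₀∘∇*_U = cR39 • coordOpK b (fun ν => O∘∇*_{U,ν})` and
`G₀∘∇*_{U,μ}` is its constant-slice family at `μ`; the probes `probeK` read one slice and are anchored slot-blind (`blkPK bP`), so n06-w5's relabelling applies.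
[cite: Balaban1985BackgroundPropagators, (3.43) p.398 + (3.39)–(3.40) p.397 + p.398 (remark after (3.47)); Balaban1984PropagatorsII, (2.51) p.232] -/
theorem h43Rd_of_pins {Z W : Type} (O : BondOpY 𝔸 i) (𝔬 : Ops (geo9K i) B (XBK κ i) (XBK κ i) Z W)
    {bI bP : FBondY i → IBondY i} (g : FBondY i → FBondY i → 𝔸ˣ) (w : FBondY i → FBondY i → ℝ) (w₀ : FBondY i → ℝ) {U₁ : B.Cfg}
    (hblk : 𝔬.blk = blkBK i bI) (hblkY : 𝔬.blkY = blkBK i bI)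
    (hG0 : 𝔬.G0 U₁ = GcoK i b B cfg O U₁) (hDs : 𝔬.Dstar U₁ = DscoK i b B cfg U₁)
    {Dds : Fin (d + 1) → Module.End ℝ (XBK κ i → ℝ)} (hDds : Dds = fun μ => coordOpK b (fun _ : Fin (d + 1) => cdsBₗ i (cfg U₁) μ))
    {R₀ : ℝ} {H₀ : Prop} {m : (geo9K i).Site → (geo9K i).Site → ℝ}
    (h : HasMajorantHom (g := toB6 (geo9K i) R₀ H₀) 𝔬.blkY (blkPK (D := Fin (d + 1)) (κ := κ) bP) (probeK b g w w₀ ∘ₗ (𝔬.G0 U₁ ∘ₗ 𝔬.Dstar U₁)) m)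
    (μ : Fin (d + 1)) :
    HasMajorantHom (g := toB6 (geo9K i) R₀ H₀) 𝔬.blk (blkPK (D := Fin (d + 1)) (κ := κ) bP) (probeK b g w w₀ ∘ₗ (𝔬.G0 U₁ ∘ₗ Dds μ)) m := by
  rw [hblkY, hG0, hDs] at h
  rw [hblk, hG0, hDds]
  change HasMajorantHom (g := toB6 (geo9K i) R₀ H₀) (fun p : XBK κ i => bI p.1) (blkPK bP)
    (probeK b g w w₀ ∘ₗ (((cR39 b) • coordOpK b (fun _ : Fin (d + 1) => (O (cfg U₁)).restrictScalars ℝ)) ∘ₗ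
      coordOpK b (fun ν : Fin (d + 1) => cdsBₗ i (cfg U₁) ν))) m at h
  change HasMajorantHom (g := toB6 (geo9K i) R₀ H₀) (fun p : XBK κ i => bI p.1) (blkPK bP)
    (probeK b g w w₀ ∘ₗ (((cR39 b) • coordOpK b (fun _ : Fin (d + 1) => (O (cfg U₁)).restrictScalars ℝ)) ∘ₗ
      coordOpK b (fun _ : Fin (d + 1) => cdsBₗ i (cfg U₁) μ))) m
  rw [← one_smul ℝ (coordOpK b (fun ν : Fin (d + 1) => cdsBₗ i (cfg U₁) ν)), smul_coordOpK_comp_smul_coordOpK] at h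
  rw [← one_smul ℝ (coordOpK b (fun _ : Fin (d + 1) => cdsBₗ i (cfg U₁) μ)), smul_coordOpK_comp_smul_coordOpK]
  exact hasMajorantHom_probe_constSlice_of_family b (G := toB6 (geo9K i) R₀ H₀) bI bP g w w₀
    (fun ν : Fin (d + 1) => (O (cfg U₁)).restrictScalars ℝ ∘ₗ cdsBₗ i (cfg U₁) ν) _ h μ

end Pins

/-! ## §2 `Letters313HZ.pXDv` at node00-def-Y's members, every `Reg335` configuration -/

section Members

variable {Mstar : ℕ} {N : ℕ} [NeZero N]
variable [∀ x : MemberY d ℓ hd hL b₀ b₁ Mstar, Fintype (geo9Y x).Site]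

/-- ★★ **`Letters313HZ.pXDv` AT THE PINS** — Φ^X_β∘G₀∘D_U : 𝔠_W⁽⁰⁾ → 𝔠_P^{(β−1)} with `Bx ≥ (d+1)·B_h·C_J·c`, `0 ≤ δ₃ ≤ δ₀`, `δ₃ + σ ≤ δ_J`, from the DERIVED slice-diagonal
right-probe member of `Thm33G0Dir.h43R`'s shape, at a record whose `blk ∕ blkY ∕ blkW ∕ G0 ∕ Dstar ∕ Dv` and probes `ΦX ∕ blkPX` are pinned as in the certificate
(`hblk12 hblkY12 hblkW12 hG0co12 hDsco12 hDvco12 h𝔡As`; the probes through `h𝔭A` at `holderProbesK` or at n06-w6's cut carrier `holderProbesKA` — any transporter `gU`,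
weights `w ∕ w₀`, anchors `blkPK bP`), every member, every `Reg335` configuration.
[cite: Balaban1985BackgroundPropagators, (3.43) p.398 + (3.40) p.397 + (3.133) p.422 + (3.3) p.390 + (3.35) p.396; Balaban1984PropagatorsII, (2.51)–(2.56) pp.232–233 + Lemma 2.1 (2.61) p.234] -/
theorem pXDv_pins (x : MemberY d ℓ hd hL b₀ b₁ Mstar) {bI : FBondY x.toKIdx → IBondY x.toKIdx}
    (hβ1 : ∀ f : FBondY x.toKIdx, (geomT x.D).dist (β x.hN x.D x.hk (bI f)) (blkV1 x.hN x.D f) ≤ 1) {c35 α₀ : ℝ}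
    {U : (bg9Y (Matrix (Fin N) (Fin N) ℂ) (specialUnitaryUnits (Fin N)) x).Cfg}
    (hU : (bg9Y (Matrix (Fin N) (Fin N) ℂ) (specialUnitaryUnits (Fin N)) x).Reg335 c35 α₀ U)
    {R₀ : ℝ} {H₀ : Prop} (hG : GeoOK (geo9Y x)) {σ c : ℝ} (hrow : RowSum (toB6 (geo9Y x) R₀ H₀) σ c)
    (𝔬 : Ops (geo9Y x) (bg9Y (Matrix (Fin N) (Fin N) ℂ) (specialUnitaryUnits (Fin N)) x) (XBK (TrIdx N) x.toKIdx) (XBK (TrIdx N) x.toKIdx)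
      (XHK (TrIdx N) x.toKIdx) (XSK (TrIdx N) x.toKIdx))
    {PY : Type} (𝔭 : HolderProbes (geo9Y x) (bg9Y (Matrix (Fin N) (Fin N) ℂ) (specialUnitaryUnits (Fin N)) x) (XBK (TrIdx N) x.toKIdx)
      (XBK (TrIdx N) x.toKIdx) (PK (FBondY x.toKIdx) (Fin (d + 1)) (TrIdx N)) PY)
    (O : BondOpY (Matrix (Fin N) (Fin N) ℂ) x.toKIdx) {bP : FBondY x.toKIdx → IBondY x.toKIdx}
    (gU : FBondY x.toKIdx → FBondY x.toKIdx → (Matrix (Fin N) (Fin N) ℂ)ˣ)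
    (w : ℝ → FBondY x.toKIdx → FBondY x.toKIdx → ℝ) (w₀ : ℝ → FBondY x.toKIdx → ℝ)
    (hblk : 𝔬.blk = blkBK x.toKIdx bI) (hblkY : 𝔬.blkY = blkBK x.toKIdx bI) (hblkW : 𝔬.blkW = blkSK x.toKIdx (sIK x.toKIdx bI))
    (hG0 : 𝔬.G0 U = GcoK x.toKIdx (trBasis N) (bg9Y (Matrix (Fin N) (Fin N) ℂ) (specialUnitaryUnits (Fin N)) x) (fun U => U) O U)
    (hDs : 𝔬.Dstar U = DscoK x.toKIdx (trBasis N) (bg9Y (Matrix (Fin N) (Fin N) ℂ) (specialUnitaryUnits (Fin N)) x) (fun U => U) U)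
    (hDv : 𝔬.Dv U = DvcoKH x.toKIdx (trBasis N) (bg9Y (Matrix (Fin N) (Fin N) ℂ) (specialUnitaryUnits (Fin N)) x) (fun U => U) U)
    {Dds : Fin (d + 1) → Module.End ℝ (XBK (TrIdx N) x.toKIdx → ℝ)}
    (hDds : Dds = fun μ => coordOpK (trBasis N) (fun _ : Fin (d + 1) => cdsBₗ x.toKIdx U μ))
    {βH : ℝ} (hΦX : 𝔭.ΦX U βH = probeK (trBasis N) gU (w βH) (w₀ βH))
    (hPX : 𝔭.blkPX = blkPK bP)
    {Bh δ₀ δJ Bx δ₃ : ℝ} (hBh : 0 ≤ Bh) (hδJ : 0 ≤ δJ) (hδ₃ : 0 ≤ δ₃) (hδ₃0 : δ₃ ≤ δ₀) (hδ₃J : δ₃ + σ ≤ δJ)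
    (hBx : ((d : ℝ) + 1) * (Bh * (cR39 (trBasis N) * Real.exp (δJ * rJ d ℓ)) * c) ≤ Bx)
    (h43R : HasMajorantHom (g := toB6 (geo9Y x) R₀ H₀) 𝔬.blkY 𝔭.blkPX (𝔭.ΦX U βH ∘ₗ (𝔬.G0 U ∘ₗ 𝔬.Dstar U))
      (fun (a b : (geo9Y x).Site) => Bh * (geo9Y x).len a ^ (1 - βH) * Real.exp (-(δ₀ * (geo9Y x).dist a b)))) :
    HasMaj (cNormR R₀ H₀ 𝔬.blkW hG.lenle 0) (cNormR R₀ H₀ 𝔭.blkPX hG.lenle (βH - 1)) ((𝔭.ΦX U βH ∘ₗ 𝔬.G0 U) ∘ₗ 𝔬.Dv U)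
      (fun a b => Bx * Real.exp (-(δ₃ * (geo9Y x).dist a b))) := by
  letI : Fintype (geo9K x.toKIdx).Site := (inferInstance : Fintype (geo9Y x).Site)
  have hDv' : 𝔬.Dv U = ∑ μ, Dds μ ∘ₗ JcoKH x.toKIdx (trBasis N) (bg9Y (Matrix (Fin N) (Fin N) ℂ) (specialUnitaryUnits (Fin N)) x) (fun U => U) μ U := by
    rw [hDv, hDds]
    exact DvcoKH_eq_sum x.toKIdx (trBasis N) (bg9Y (Matrix (Fin N) (Fin N) ℂ) (specialUnitaryUnits (Fin N)) x) (fun U => U) U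
  have hJ : ∀ μ, HasMaj (cNorm R₀ H₀ 𝔬.blkW hG.lenle 0) (cNorm R₀ H₀ 𝔬.blk hG.lenle 0)
      (JcoKH x.toKIdx (trBasis N) (bg9Y (Matrix (Fin N) (Fin N) ℂ) (specialUnitaryUnits (Fin N)) x) (fun U => U) μ U)
      (fun a b => cR39 (trBasis N) * Real.exp (δJ * rJ d ℓ) * Real.exp (-(δJ * (geo9Y x).dist a b))) := fun μ => by
    rw [hblk, hblkW]
    exact hasMaj_JcoKH_pins x hβ1 hU hδJ hG.lenle μ
  -- the directional right-probe member by slice relabelling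
  have h43Rd : ∀ μ, HasMajorantHom (g := toB6 (geo9Y x) R₀ H₀) 𝔬.blk 𝔭.blkPX (𝔭.ΦX U βH ∘ₗ (𝔬.G0 U ∘ₗ Dds μ))
      (fun (a b : (geo9Y x).Site) => Bh * (geo9Y x).len a ^ (1 - βH) * Real.exp (-(δ₀ * (geo9Y x).dist a b))) := by
    intro μ
    rw [hPX, hΦX]
    rw [hPX, hΦX] at h43R
    exact h43Rd_of_pins x.toKIdx (trBasis N) (bg9Y (Matrix (Fin N) (Fin N) ℂ) (specialUnitaryUnits (Fin N)) x) (fun U => U) O 𝔬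
      gU (w βH) (w₀ βH) hblk hblkY hG0 hDs hDds h43R μ
  have hBx' : (Fintype.card (Fin (d + 1)) : ℝ) * (Bh * (cR39 (trBasis N) * Real.exp (δJ * rJ d ℓ)) * c) ≤ Bx := by
    rw [Fintype.card_fin, Nat.cast_add, Nat.cast_one]; exact hBx
  exact pXDv_of_h43Rd hG hrow hBh (mul_nonneg (cR39_nonneg _) (Real.exp_nonneg _)) hδ₃ hδ₃0 hδ₃J hBx' hDv' h43Rd hJ

end Members

end Literature.MathematicalPhysics.QuantumFieldTheory.Balaban1983to89.B9Thm313WholeDvProbeAtPins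

end
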